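import Summits.CriticalPhenomena.Ising3DConformalLimit.Theorems.GapForcesFarMerging.Negative.LineShapes
import Summits.CriticalPhenomena.Ising3DConformalLimit.Theorems.GapForcesFarMerging.Negative.NotRP

/-!
# `GapForcesFarMerging`: the line `rp-unpinch-single-passage` is soft except at quasi-multiplicativity, II

Part 2/4 — FAMILY A′ EVALUATED: sup norms of the vectors of the four configurations
`w = (0, e₂, up m, dn m)`, `v = (0, src s, up m, dn m)`, `u = (m e₂, −m e₂, up m, dn m)` (mirror
images of the targets) and the GAP configuration `x = (0, e₂, 2m e₁, 2m e₁ + e₂)`; on all of them every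
pair value of `S₀` except the sources' equals `q m = 1/(1+2m)`, `Pmin = q²`, and the four truncations of
A′ are `T_{A′}(e₂;m) = 2q⁴` (`TS_w`), `T_{A′}(src s;m) = 2q²(1 − (1−q²)/s)` (`TS_v`), the un-pinched
pair–pair factor `2q²(1 − (1−q²)/(2m))` (`pairpair_u`), the GAP quantity `2q⁴` (`gapq_x`); `Npar = q²`.

## References

* M. Aizenman, Comm. Math. Phys. 86 (1982) 1–48, §§4–5 [AizenmanCMP1982].
* M. Aizenman, H. Duminil-Copin, Ann. Math. 194 (2021), §3 eqs. (3.7), (3.11)–(3.12), §5.1 eq. (5.3)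
  [AizenmanDuminilCopinAnnals2021].
* J. Fröhlich, R. Israel, E. H. Lieb, B. Simon, Comm. Math. Phys. 62 (1978) 1–34, Thm. 2.1 [FILS1978].
* G. F. Lawler, Intersections of Random Walks (1991), ch. 3–5 [Lawler1991].
-/

noncomputable section

namespace Summit.CriticalPhenomena.Ising3DConformalLimit.Theorems.GapForcesFarMerging.Negative

open Literature.Probability.LatticeModels

/-! ### Sup norms of the vectors of the isosceles configurations -/

/-- `‖(a, b, 0)‖_∞ = max |a| |b|`. [folklore] -/
theorem norm_vec2 (a b : ℤ) : ‖(![a, b, 0] : Site 3)‖ = max |(a : ℝ)| |(b : ℝ)| := by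
  rw [norm_vec3]; simp

/-- Sup norm of `(a,b,0)` when `|a|` dominates. [folklore] -/
theorem norm_vec2_left {a b : ℤ} {M : ℝ} (h1 : |(a : ℝ)| = M) (h2 : |(b : ℝ)| ≤ M) :
    ‖(![a, b, 0] : Site 3)‖ = M := by
  rw [norm_vec2, ← h1]; exact max_eq_left (h1 ▸ h2)

/-- Sup norm of `(a,b,0)` when `|b|` dominates. [folklore] -/
theorem norm_vec2_right {a b : ℤ} {M : ℝ} (h1 : |(a : ℝ)| ≤ M) (h2 : |(b : ℝ)| = M) :
    ‖(![a, b, 0] : Site 3)‖ = M := by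
  rw [norm_vec2, ← h2]; exact max_eq_right (h2 ▸ h1)

/-- `sep` from the six unordered pairwise distances. [folklore] -/
theorem le_sep₆ {y : Fin 4 → Site 3} {r : ℝ} (h01 : r ≤ ‖y 0 - y 1‖) (h02 : r ≤ ‖y 0 - y 2‖)
    (h03 : r ≤ ‖y 0 - y 3‖) (h12 : r ≤ ‖y 1 - y 2‖) (h13 : r ≤ ‖y 1 - y 3‖) (h23 : r ≤ ‖y 2 - y 3‖) :
    r ≤ sep y :=
  le_min h01 (le_min h02 (le_min h03 (le_min h12 (le_min h13 h23))))

variable (m s : ℕ)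

/-- `up m` as an explicit triple. [folklore] -/
theorem up_eq : up m = ![2 * (m : ℤ), (m : ℤ), 0] := by
  ext i; fin_cases i <;> simp [up, xR]
/-- `dn m` as an explicit triple. [folklore] -/
theorem dn_eq : dn m = ![2 * (m : ℤ), -(m : ℤ), 0] := by
  ext i; fin_cases i <;> simp [dn, xR]
/-- `xR m` as an explicit triple. [folklore] -/
theorem xR_eq : xR m = ![2 * (m : ℤ), 0, 0] := by
  ext i; fin_cases i <;> simp [xR]
/-- `dn m - e₂` as an explicit triple. [folklore] -/
theorem dn_sub_e₂ : dn m - e₂ = ![2 * (m : ℤ), -(m : ℤ) - 1, 0] := by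
  ext i; fin_cases i <;> simp [dn, xR]
/-- `up m - e₂` as an explicit triple. [folklore] -/
theorem up_sub_e₂ : up m - e₂ = ![2 * (m : ℤ), (m : ℤ) - 1, 0] := by
  ext i; fin_cases i <;> simp [up, xR]
/-- `dn m - up m` as an explicit triple. [folklore] -/
theorem dn_sub_up : dn m - up m = ![0, -(2 * (m : ℤ)), 0] := by
  ext i; fin_cases i <;> simp [up, dn, xR]; ring
/-- `src s` as an explicit triple. [folklore] -/
theorem src_eq : src s = ![0, (s : ℤ), 0] := by
  ext i; fin_cases i <;> simp [src]
/-- `up m - src s` as an explicit triple. [folklore] -/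
theorem up_sub_src : up m - src s = ![2 * (m : ℤ), (m : ℤ) - s, 0] := by
  ext i; fin_cases i <;> simp [up, xR, src]
/-- `dn m - src s` as an explicit triple. [folklore] -/
theorem dn_sub_src : dn m - src s = ![2 * (m : ℤ), -(m : ℤ) - s, 0] := by
  ext i; fin_cases i <;> simp [dn, xR, src]
/-- `xR m + e₂` as an explicit triple. [folklore] -/
theorem xR_add_e₂ : xR m + e₂ = ![2 * (m : ℤ), 1, 0] := by
  ext i; fin_cases i <;> simp [xR]
/-- `xR m - e₂` as an explicit triple. [folklore] -/
theorem xR_sub_e₂ : xR m - e₂ = ![2 * (m : ℤ), -1, 0] := by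
  ext i; fin_cases i <;> simp [xR]
/-- `-m e₂ - m e₂` as an explicit triple. [folklore] -/
theorem negm_sub_m : (Pi.single 1 (-(m : ℤ)) : Site 3) - Pi.single 1 (m : ℤ) = ![0, -(2 * (m : ℤ)), 0] := by
  ext i; fin_cases i <;> simp; ring
/-- `up m - m e₂` as an explicit triple. [folklore] -/
theorem up_sub_m : up m - Pi.single 1 (m : ℤ) = ![2 * (m : ℤ), 0, 0] := by
  ext i; fin_cases i <;> simp [up, xR]
/-- `dn m - m e₂` as an explicit triple. [folklore] -/
theorem dn_sub_m : dn m - Pi.single 1 (m : ℤ) = ![2 * (m : ℤ), -(2 * (m : ℤ)), 0] := by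
  ext i; fin_cases i <;> simp [dn, xR]; ring
/-- `up m + m e₂` as an explicit triple. [folklore] -/
theorem up_sub_negm : up m - Pi.single 1 (-(m : ℤ)) = ![2 * (m : ℤ), 2 * (m : ℤ), 0] := by
  ext i; fin_cases i <;> simp [up, xR]; ring
/-- `dn m + m e₂` as an explicit triple. [folklore] -/
theorem dn_sub_negm : dn m - Pi.single 1 (-(m : ℤ)) = ![2 * (m : ℤ), 0, 0] := by
  ext i; fin_cases i <;> simp [dn, xR]
/-- `xR m = (2m) • e₁`. [folklore] -/
theorem xR_eq_smul : xR m = (((2 * m : ℕ) : ℤ)) • (e₁ : Site 3) := by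
  ext i; fin_cases i <;> simp [xR]

/-- `q m = 1/(1+2m)`, the common value of `S₀` on the isosceles configurations. [folklore] -/
def q : ℝ := (1 + 2 * (m : ℝ))⁻¹

/-- `q m > 0`. [folklore] -/
theorem q_pos : 0 < q m := by unfold q; positivity

variable {m s}

section gvals
variable (hm : 1 ≤ m)
include hm

/-- `1 ≤ m` in `ℝ`. [folklore] -/
theorem one_le_m : (1 : ℝ) ≤ m := by exact_mod_cast hm

/-- The norms `2m`. [folklore] -/
theorem norm_up : ‖up m‖ = 2 * (m : ℝ) := by
  have := one_le_m hm
  rw [up_eq]; exact norm_vec2_left (by push_cast; rw [abs_of_nonneg (by positivity)])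
    (by push_cast; rw [abs_of_nonneg (by positivity)]; linarith)
/-- `‖dn m‖ = 2m`. [folklore] -/
theorem norm_dn : ‖dn m‖ = 2 * (m : ℝ) := by
  have := one_le_m hm
  rw [dn_eq]; exact norm_vec2_left (by push_cast; rw [abs_of_nonneg (by positivity)])
    (by push_cast; rw [abs_neg, abs_of_nonneg (by positivity)]; linarith)
/-- `‖xR m‖ = 2m`. [folklore] -/
theorem norm_xR' : ‖xR m‖ = 2 * (m : ℝ) := by
  have := one_le_m hm
  rw [xR_eq]; exact norm_vec2_left (by push_cast; rw [abs_of_nonneg (by positivity)]) (by simp)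
/-- `‖dn m - e₂‖ = 2m`. [folklore] -/
theorem norm_dn_sub_e₂ : ‖dn m - e₂‖ = 2 * (m : ℝ) := by
  have := one_le_m hm
  rw [dn_sub_e₂]; exact norm_vec2_left (by push_cast; rw [abs_of_nonneg (by positivity)])
    (by push_cast; rw [abs_le]; constructor <;> linarith)
/-- `‖up m - e₂‖ = 2m`. [folklore] -/
theorem norm_up_sub_e₂ : ‖up m - e₂‖ = 2 * (m : ℝ) := by
  have := one_le_m hm
  rw [up_sub_e₂]; exact norm_vec2_left (by push_cast; rw [abs_of_nonneg (by positivity)])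
    (by push_cast; rw [abs_le]; constructor <;> linarith)
/-- `‖dn m - up m‖ = 2m`. [folklore] -/
theorem norm_dn_sub_up : ‖dn m - up m‖ = 2 * (m : ℝ) := by
  have := one_le_m hm
  rw [dn_sub_up]; exact norm_vec2_right (by simp)
    (by push_cast; rw [abs_neg, abs_of_nonneg (by positivity)])
/-- `‖xR m + e₂‖ = 2m`. [folklore] -/
theorem norm_xR_add_e₂ : ‖xR m + e₂‖ = 2 * (m : ℝ) := by
  have := one_le_m hm
  rw [xR_add_e₂]; exact norm_vec2_left (by push_cast; rw [abs_of_nonneg (by positivity)])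
    (by push_cast; rw [abs_le]; constructor <;> linarith)
/-- `‖xR m - e₂‖ = 2m`. [folklore] -/
theorem norm_xR_sub_e₂ : ‖xR m - e₂‖ = 2 * (m : ℝ) := by
  have := one_le_m hm
  rw [xR_sub_e₂]; exact norm_vec2_left (by push_cast; rw [abs_of_nonneg (by positivity)])
    (by push_cast; rw [abs_le]; constructor <;> linarith)
/-- `‖-m e₂ - m e₂‖ = 2m`. [folklore] -/
theorem norm_negm_sub_m : ‖(Pi.single 1 (-(m : ℤ)) : Site 3) - Pi.single 1 (m : ℤ)‖ = 2 * (m : ℝ) := by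
  have := one_le_m hm
  rw [negm_sub_m]; exact norm_vec2_right (by simp)
    (by push_cast; rw [abs_neg, abs_of_nonneg (by positivity)])
/-- `‖up m - m e₂‖ = 2m`. [folklore] -/
theorem norm_up_sub_m : ‖up m - Pi.single 1 (m : ℤ)‖ = 2 * (m : ℝ) := by
  have := one_le_m hm
  rw [up_sub_m]; exact norm_vec2_left (by push_cast; rw [abs_of_nonneg (by positivity)]) (by simp)
/-- `‖dn m - m e₂‖ = 2m`. [folklore] -/
theorem norm_dn_sub_m : ‖dn m - Pi.single 1 (m : ℤ)‖ = 2 * (m : ℝ) := by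
  have := one_le_m hm
  rw [dn_sub_m]; exact norm_vec2_left (by push_cast; rw [abs_of_nonneg (by positivity)])
    (by push_cast; rw [abs_neg, abs_of_nonneg (by positivity)])
/-- `‖up m + m e₂‖ = 2m`. [folklore] -/
theorem norm_up_sub_negm : ‖up m - Pi.single 1 (-(m : ℤ))‖ = 2 * (m : ℝ) := by
  have := one_le_m hm
  rw [up_sub_negm]; exact norm_vec2_left (by push_cast; rw [abs_of_nonneg (by positivity)])
    (by push_cast; rw [abs_of_nonneg (by positivity)])
/-- `‖dn m + m e₂‖ = 2m`. [folklore] -/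
theorem norm_dn_sub_negm : ‖dn m - Pi.single 1 (-(m : ℤ))‖ = 2 * (m : ℝ) := by
  have := one_le_m hm
  rw [dn_sub_negm]; exact norm_vec2_left (by push_cast; rw [abs_of_nonneg (by positivity)]) (by simp)

end gvals

/-- `‖src s‖ = s`. [folklore] -/
theorem norm_src (s : ℕ) : ‖src s‖ = (s : ℝ) := by
  rw [src_eq]; exact norm_vec2_right (by simp) (by push_cast; rw [abs_of_nonneg (by positivity)])

section gvals2
variable (hs : 1 ≤ s) (hsm : s ≤ m)
include hs hsm
/-- `‖up m - src s‖ = 2m` for `1 ≤ s ≤ m`. [folklore] -/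
theorem norm_up_sub_src : ‖up m - src s‖ = 2 * (m : ℝ) := by
  have h1 : (1 : ℝ) ≤ s := by exact_mod_cast hs
  have h2 : (s : ℝ) ≤ m := by exact_mod_cast hsm
  rw [up_sub_src]; exact norm_vec2_left (by push_cast; rw [abs_of_nonneg (by positivity)])
    (by push_cast; rw [abs_le]; constructor <;> linarith)
/-- `‖dn m - src s‖ = 2m` for `1 ≤ s ≤ m`. [folklore] -/
theorem norm_dn_sub_src : ‖dn m - src s‖ = 2 * (m : ℝ) := by
  have h1 : (1 : ℝ) ≤ s := by exact_mod_cast hs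
  have h2 : (s : ℝ) ≤ m := by exact_mod_cast hsm
  rw [dn_sub_src]; exact norm_vec2_left (by push_cast; rw [abs_of_nonneg (by positivity)])
    (by push_cast; rw [abs_le]; constructor <;> linarith)

end gvals2

/-! ### Values of `S₀`, `P₁,P₂,P₃`, `Pmin`, `sep`, `θ_{A′}` on the four configurations -/

/-- `g v = q m` once `‖v‖ = 2m`. [folklore] -/
theorem g_of_norm {v : Site 3} (h : ‖v‖ = 2 * (m : ℝ)) : g v = q m := by rw [g_eq, h, q]

section evals
variable (hm : 1 ≤ m)
include hm

/-- `q m ≤ 1/2`. [folklore] -/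
theorem q_le_half : q m ≤ 1 / 2 := by
  have := one_le_m hm
  rw [q, one_div]; exact inv_anti₀ (by norm_num) (by linarith)

/-- `q² ≤ q/2`. [folklore] -/
theorem qq_le : q m * q m ≤ 1 / 2 * q m := by
  have := q_le_half hm; have := q_pos m; nlinarith

/-- Configuration `w = (0, e₂, up m, dn m)`. [folklore] -/
theorem evals_w :
    P₁ S₀ ![0, e₂, up m, dn m] = 1 / 2 * q m ∧ P₂ S₀ ![0, e₂, up m, dn m] = q m * q m ∧
      P₃ S₀ ![0, e₂, up m, dn m] = q m * q m ∧ pmin S₀ ![0, e₂, up m, dn m] = q m * q m ∧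
      sep ![0, e₂, up m, dn m] = 1 := by
  have h1 : P₁ S₀ ![0, e₂, up m, dn m] = 1 / 2 * q m := by
    simp only [P₁, S₀, Matrix.cons_val_zero, Matrix.cons_val_one, Matrix.cons_val, sub_zero, g_e₂,
      g_of_norm (norm_dn_sub_up hm)]
  have h2 : P₂ S₀ ![0, e₂, up m, dn m] = q m * q m := by
    simp only [P₂, S₀, Matrix.cons_val_zero, Matrix.cons_val_one, Matrix.cons_val, sub_zero,
      g_of_norm (norm_up hm), g_of_norm (norm_dn_sub_e₂ hm)]
  have h3 : P₃ S₀ ![0, e₂, up m, dn m] = q m * q m := by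
    simp only [P₃, S₀, Matrix.cons_val_zero, Matrix.cons_val_one, Matrix.cons_val, sub_zero,
      g_of_norm (norm_dn hm), g_of_norm (norm_up_sub_e₂ hm)]
  refine ⟨h1, h2, h3, ?_, ?_⟩
  · rw [pmin, h1, h2, h3, min_eq_right (qq_le hm), min_self]
  · apply le_antisymm
    · have h := sep_le_norm ![0, e₂, up m, dn m] (i := 0) (j := 1) (by decide)
      simpa [norm_e₂] using h
    · have := one_le_m hm
      refine le_sep₆ ?_ ?_ ?_ ?_ ?_ ?_ <;>
        simp only [Matrix.cons_val_zero, Matrix.cons_val_one, Matrix.cons_val, zero_sub, norm_neg,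
          norm_e₂, norm_up hm, norm_dn hm, ← norm_neg (e₂ - up m), ← norm_neg (e₂ - dn m),
          ← norm_neg (up m - dn m), neg_sub, norm_dn_sub_e₂ hm, norm_up_sub_e₂ hm, norm_dn_sub_up hm] <;>
        linarith

/-- Configuration `v = (0, src s, up m, dn m)`, `1 ≤ s ≤ m`. [folklore] -/
theorem evals_v (hs : 1 ≤ s) (hsm : s ≤ m) :
    P₁ S₀ ![0, src s, up m, dn m] = (1 + (s : ℝ))⁻¹ * q m ∧ P₂ S₀ ![0, src s, up m, dn m] = q m * q m ∧
      P₃ S₀ ![0, src s, up m, dn m] = q m * q m ∧ pmin S₀ ![0, src s, up m, dn m] = q m * q m ∧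
      sep ![0, src s, up m, dn m] = s := by
  have hs1 : (1 : ℝ) ≤ s := by exact_mod_cast hs
  have hsm' : (s : ℝ) ≤ m := by exact_mod_cast hsm
  have h1 : P₁ S₀ ![0, src s, up m, dn m] = (1 + (s : ℝ))⁻¹ * q m := by
    simp only [P₁, S₀, Matrix.cons_val_zero, Matrix.cons_val_one, Matrix.cons_val, sub_zero, g_eq (src s),
      norm_src, g_of_norm (norm_dn_sub_up hm)]
  have h2 : P₂ S₀ ![0, src s, up m, dn m] = q m * q m := by
    simp only [P₂, S₀, Matrix.cons_val_zero, Matrix.cons_val_one, Matrix.cons_val, sub_zero,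
      g_of_norm (norm_up hm), g_of_norm (norm_dn_sub_src hs hsm)]
  have h3 : P₃ S₀ ![0, src s, up m, dn m] = q m * q m := by
    simp only [P₃, S₀, Matrix.cons_val_zero, Matrix.cons_val_one, Matrix.cons_val, sub_zero,
      g_of_norm (norm_dn hm), g_of_norm (norm_up_sub_src hs hsm)]
  have hq1 : q m ≤ (1 + (s : ℝ))⁻¹ := by
    rw [q]; exact inv_anti₀ (by positivity) (by linarith)
  refine ⟨h1, h2, h3, ?_, ?_⟩
  · rw [pmin, h1, h2, h3, min_eq_right (mul_le_mul_of_nonneg_right hq1 (q_pos m).le), min_self]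
  · apply le_antisymm
    · have h := sep_le_norm ![0, src s, up m, dn m] (i := 0) (j := 1) (by decide)
      simpa [norm_src] using h
    · have := one_le_m hm
      refine le_sep₆ ?_ ?_ ?_ ?_ ?_ ?_ <;>
        simp only [Matrix.cons_val_zero, Matrix.cons_val_one, Matrix.cons_val, zero_sub, norm_neg,
          norm_src, norm_up hm, norm_dn hm, ← norm_neg (src s - up m), ← norm_neg (src s - dn m),
          ← norm_neg (up m - dn m), neg_sub, norm_dn_sub_src hs hsm, norm_up_sub_src hs hsm,
          norm_dn_sub_up hm] <;>
        linarith

/-- Configuration `u = (m e₂, -m e₂, up m, dn m)` (the mirror images of the targets). [folklore] -/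
theorem evals_u :
    P₁ S₀ ![Pi.single 1 (m : ℤ), Pi.single 1 (-(m : ℤ)), up m, dn m] = q m * q m ∧
      P₂ S₀ ![Pi.single 1 (m : ℤ), Pi.single 1 (-(m : ℤ)), up m, dn m] = q m * q m ∧
      P₃ S₀ ![Pi.single 1 (m : ℤ), Pi.single 1 (-(m : ℤ)), up m, dn m] = q m * q m ∧
      pmin S₀ ![Pi.single 1 (m : ℤ), Pi.single 1 (-(m : ℤ)), up m, dn m] = q m * q m ∧
      sep ![Pi.single 1 (m : ℤ), Pi.single 1 (-(m : ℤ)), up m, dn m] = 2 * (m : ℝ) := by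
  have h1 : P₁ S₀ ![Pi.single 1 (m : ℤ), Pi.single 1 (-(m : ℤ)), up m, dn m] = q m * q m := by
    simp only [P₁, S₀, Matrix.cons_val_zero, Matrix.cons_val_one, Matrix.cons_val,
      g_of_norm (norm_negm_sub_m hm), g_of_norm (norm_dn_sub_up hm)]
  have h2 : P₂ S₀ ![Pi.single 1 (m : ℤ), Pi.single 1 (-(m : ℤ)), up m, dn m] = q m * q m := by
    simp only [P₂, S₀, Matrix.cons_val_zero, Matrix.cons_val_one, Matrix.cons_val,
      g_of_norm (norm_up_sub_m hm), g_of_norm (norm_dn_sub_negm hm)]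
  have h3 : P₃ S₀ ![Pi.single 1 (m : ℤ), Pi.single 1 (-(m : ℤ)), up m, dn m] = q m * q m := by
    simp only [P₃, S₀, Matrix.cons_val_zero, Matrix.cons_val_one, Matrix.cons_val,
      g_of_norm (norm_dn_sub_m hm), g_of_norm (norm_up_sub_negm hm)]
  refine ⟨h1, h2, h3, ?_, ?_⟩
  · rw [pmin, h1, h2, h3, min_self, min_self]
  · apply le_antisymm
    · have h := sep_le_norm ![Pi.single 1 (m : ℤ), Pi.single 1 (-(m : ℤ)), up m, dn m] (i := 0) (j := 1)
        (by decide)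
      simp only [Matrix.cons_val_zero, Matrix.cons_val_one] at h
      rwa [← norm_neg, neg_sub, norm_negm_sub_m hm] at h
    · have := one_le_m hm
      refine le_sep₆ ?_ ?_ ?_ ?_ ?_ ?_ <;>
        simp only [Matrix.cons_val_zero, Matrix.cons_val_one, Matrix.cons_val] <;>
        first
          | rw [norm_sub_rev, norm_negm_sub_m hm]
          | rw [norm_sub_rev, norm_up_sub_m hm]
          | rw [norm_sub_rev, norm_dn_sub_m hm]
          | rw [norm_sub_rev, norm_up_sub_negm hm]
          | rw [norm_sub_rev, norm_dn_sub_negm hm]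
          | rw [norm_sub_rev, norm_dn_sub_up hm]

/-- The GAP configuration `(0, e₂, xR m, xR m + e₂)`. [folklore] -/
theorem evals_x :
    g (xR m) = q m ∧ g (xR m + e₂) = q m ∧ g (xR m - e₂) = q m ∧
      pmin S₀ ![0, e₂, xR m, xR m + e₂] = q m * q m ∧ sep ![0, e₂, xR m, xR m + e₂] = 1 := by
  have h1 := g_of_norm (norm_xR' hm)
  have h2 := g_of_norm (norm_xR_add_e₂ hm)
  have h3 := g_of_norm (norm_xR_sub_e₂ hm)
  refine ⟨h1, h2, h3, ?_, ?_⟩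
  · rw [pmin_adjacent_eq, h1, h2, h3, g_e₂]
    have hq := q_le_half hm
    have hq0 := q_pos m
    exact min_eq_right (le_min (by nlinarith) le_rfl)
  · rw [xR_eq_smul]; exact sep_adjacent_eq_one (2 * m) (by omega)

/-- `θ_{A′}` on the four configurations. [folklore] -/
theorem θA'_w : θA' ![0, e₂, up m, dn m] = 1 - q m * q m := by
  obtain ⟨-, -, -, hp, hsep⟩ := evals_w hm
  rw [θA', θA, hp, hsep]; simp

/-- `θ_{A′}(v) = (1 - q²)/s`. [folklore] -/
theorem θA'_v (hs : 1 ≤ s) (hsm : s ≤ m) : θA' ![0, src s, up m, dn m] = (s : ℝ)⁻¹ * (1 - q m * q m) := by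
  obtain ⟨-, -, -, hp, hsep⟩ := evals_v hm hs hsm
  have hs1 : (1 : ℝ) ≤ s := by exact_mod_cast hs
  rw [θA', θA, hp, hsep, max_eq_right hs1, min_eq_left hs1]; ring

/-- `θ_{A′}(u) = (1 - q²)/(2m)`. [folklore] -/
theorem θA'_u : θA' ![Pi.single 1 (m : ℤ), Pi.single 1 (-(m : ℤ)), up m, dn m] =
    (2 * (m : ℝ))⁻¹ * (1 - q m * q m) := by
  obtain ⟨-, -, -, hp, hsep⟩ := evals_u hm
  have := one_le_m hm
  rw [θA', θA, hp, hsep, max_eq_right (by linarith), min_eq_left (by linarith)]; ring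

/-- `θ_{A′}(x) = 1 - q²`. [folklore] -/
theorem θA'_x : θA' ![0, e₂, xR m, xR m + e₂] = 1 - q m * q m := by
  obtain ⟨-, -, -, hp, hsep⟩ := evals_x hm
  rw [θA', θA, hp, hsep]; simp

/-! ### The four truncations of family A′ -/

/-- `T_{A′}(e₂; m) = 2q⁴`. [folklore] -/
theorem TS_w : FA' ![0, e₂, up m, dn m] - S₀ 0 e₂ * S₀ (up m) (dn m) = 2 * (q m * q m) ^ 2 := by
  obtain ⟨h1, h2, h3, hp, -⟩ := evals_w hm
  have hP1 : S₀ 0 e₂ * S₀ (up m) (dn m) = P₁ S₀ ![0, e₂, up m, dn m] := by simp [P₁]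
  rw [hP1, FA', Fθ, wick, hp, θA'_w hm, h1, h2, h3]; ring

/-- `Npar_{A′}(e₂; m) = q²`. [folklore] -/
theorem Npar_w : S₀ 0 (dn m) * S₀ e₂ (up m) = q m * q m := by
  obtain ⟨-, -, h3, -, -⟩ := evals_w hm
  simpa [P₃] using h3

/-- `T_{A′}(src s; m) = 2q²(1 - (1-q²)/s)`. [folklore] -/
theorem TS_v (hs : 1 ≤ s) (hsm : s ≤ m) :
    FA' ![0, src s, up m, dn m] - S₀ 0 (src s) * S₀ (up m) (dn m) =
      2 * (q m * q m) * (1 - (s : ℝ)⁻¹ * (1 - q m * q m)) := by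
  obtain ⟨h1, h2, h3, hp, -⟩ := evals_v hm hs hsm
  have hP1 : S₀ 0 (src s) * S₀ (up m) (dn m) = P₁ S₀ ![0, src s, up m, dn m] := by simp [P₁]
  rw [hP1, FA', Fθ, wick, hp, θA'_v hm hs hsm, h1, h2, h3]; ring

/-- `Npar_{A′}(src s; m) = q²`. [folklore] -/
theorem Npar_v (hs : 1 ≤ s) (hsm : s ≤ m) : S₀ 0 (dn m) * S₀ (src s) (up m) = q m * q m := by
  obtain ⟨-, -, h3, -, -⟩ := evals_v hm hs hsm
  simpa [P₃] using h3

/-- The un-pinched pair–pair factor of A′: `2q²(1 - (1-q²)/(2m))`. [folklore] -/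
theorem pairpair_u :
    FA' ![Pi.single 1 (m : ℤ), Pi.single 1 (-(m : ℤ)), up m, dn m] -
        S₀ (Pi.single 1 (m : ℤ)) (Pi.single 1 (-(m : ℤ))) * S₀ (up m) (dn m) =
      2 * (q m * q m) * (1 - (2 * (m : ℝ))⁻¹ * (1 - q m * q m)) := by
  obtain ⟨h1, h2, h3, hp, -⟩ := evals_u hm
  have hP1 : S₀ (Pi.single 1 (m : ℤ)) (Pi.single 1 (-(m : ℤ))) * S₀ (up m) (dn m) =
      P₁ S₀ ![Pi.single 1 (m : ℤ), Pi.single 1 (-(m : ℤ)), up m, dn m] := by simp [P₁]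
  rw [hP1, FA', Fθ, wick, hp, θA'_u hm, h1, h2, h3]; ring

/-- The GAP quantity of A′ at `x = 2m e₁`: `2q⁴` (family A's part vanishes on the axis). [folklore] -/
theorem gapq_x : FA' ![0, e₂, xR m, xR m + e₂] - S₀ 0 e₂ * S₀ (xR m) (xR m + e₂) = 2 * (q m * q m) ^ 2 := by
  obtain ⟨h1, h2, h3, hp, -⟩ := evals_x hm
  rw [FA', adjacent_trunc_eq, hp, θA'_x hm, h1, h2, h3]; ring

end evals

end Summit.CriticalPhenomena.Ising3DConformalLimit.Theorems.GapForcesFarMerging.Negative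

end
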